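import Summits.QuantumFields.YangMills.Theorems.UnitScaleTiltProp7BlendSite
import HarnessLib

/-!
# Route `UnitScaleTilt`, crux K1 child «MinimiserStabilityRegPr» (stmt-QuantumFields-19200), registered stub `stub_prop7From14` (skeleton birth_v7
# cc37a178…; leaf V3 «Prop 7 from a background (14)») — THE BLENDED COMB GAUGE: A (4)-REPRESENTATIVE WITH `‖W_bU₀,b⁻¹ − 1‖ ≤ C(ε₀ + e₀)·L^{−(K−n)}`
# ON EVERY BOND, UNIFORMLY IN `k = K − n` AND IN THE VOLUME

Cell `ym3-torus` ∕ fleet seat `ym-ust-19200-p1` (gen 9; HUMAN RULING D-0037, YM ladder rung R3).  WHY.  The (4)-internal `ℓ²` route to clause 1 of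
[Balaban1985Variational] Prop. 7 at the T³ carrier (CARD-19200-V3-g3 … -g7) needs, for two elements `W, U₀` of one regular (0.4)-fibre, an element `g` of
print's group (4) (`g = 1` at the `(K−n)`-fold centres) such that `W^g` is `O((ε₀ + e₀)η)`-close to `U₀` on EVERY bond, `η = L^{−(K−n)}` — the sup input
of the Taylor expansion (gen 2 `Prop7CovariantLocalMinimality`, bond radius `ε₂η`).  The complete comb axial gauge of gen 7 gives `O((ε₀ + e₀)η)` inside the
blocks but only `O(ε₀ + e₀)` on their faces ([Balaban1985RegularSpaces] Lemma 1, `Prop7AxialLemma1`), and the `ℓ²`-optimal representative carries point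
charges at the centres (CARD-g7: «obstruction»).  THIS FILE proves that the obstruction is a property of those two representatives, not of the orbit: the
BLEND of the `2³` comb gauges of the centres surrounding each site — the geodesic trilinear interpolation in `SU(2)` (`Prop7GeodesicInterp`,
`Prop7GeodesicBlend`) of gen 7's explicit comb elements `v_y(z) = U₀(Γ_{y,z})⁻¹W(Γ_{y,z})`, with weights the fractional position of `z` in its cell of
centres (`Prop7BlendCells`) — lies in the group (4) (at a centre the blend is the own comb element, `= 1`) and achieves `‖(W^g)_bU₀,b⁻¹ − 1‖ ≤
551088·(ε₀ + e₀)·L^{−(K−n)}` on every bond (`Prop7BlendBond`, `Prop7BlendCorners`, `Prop7BlendSite`): along a bond the eight comb elements move by ONE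
two-sided translation up to the interior comb error, the weights move by `η`, and the eight elements are pairwise `O(ε₀ + e₀)`-close.

WHAT IS PROVED (sorry-free, no definition; `L ≥ 7`, `50(500L + 7L²)e ≤ 1` for both radii, `538800(ε₀ + e₀) ≤ 1`).
**`exists_blendedGauge_T3`**: for `U₀ ∈ 𝔘_k(e₀) ∩ 𝔅_k(V)`, `W ∈ 𝔘_k(ε₀) ∩ 𝔅_k(V)` there is `g` with `g↓ = 1` (group (4)), `W^g ∈ 𝔘_k(ε₀) ∩ 𝔅_k(V)`, and
`‖pertVar U₀ W^g b‖ ≤ 551088(ε₀ + e₀)L^{−(K−n)}` for EVERY bond `b`.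

HONEST SCOPE.  A kernel theorem about the carrier's lattice objects (no statement of [Balaban1985Variational] is proved); count-neutral helper toward
stmt-QuantumFields-19200 (`--supports`).  The constant is not optimised.  What the `ℓ²` route still needs after this file is recorded in CARD-19200-V3-g9.md
(Taylor expansion with the curl factor in HS form — gen 2; an `ℓ²` Poincaré inequality for THIS representative; the first variation along the fibre from
R2-minimality).

References: T. Bałaban, CMP 102 (1985) 277–309 [Balaban1985Variational] ((4) p.278, (18) p.280, Prop. 7 p.299); CMP 99 (1985) 75–102
[Balaban1985RegularSpaces] (Lemma 1 (1.24)–(1.26) p.79, p.80); CMP 98 (1985) 17–51 [Balaban1985Averaging] ((8) p.18, (21)–(27) pp.21–22).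
-/

noncomputable section

open NormedSpace
open scoped Matrix.Norms.L2Operator

namespace Summit.QuantumFields.YangMills.Theorems.Prop7BlendedGauge

open Literature.MathematicalPhysics.QuantumFieldTheory.Balaban1983to89
open T4Continuum BlockAveraging
open B10Eq27TorusAxialLog (axialT rel transl transl_apply transl_zero axialT_self)
open B7Prop1Explicit renaming Site → LSite
open B5Eq118OneStroke (iterBlockOf)
open B15DeterminingSets (embIter)
open MatrixLog (mlog)
open Literature.MathematicalPhysics.QuantumFieldTheory.Balaban1983to89.T3ContinuumYM3Torus
open Literature.MathematicalPhysics.QuantumFieldTheory.Balaban1983to89.T3UnitLawDensityEML (ℰp)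
open Literature.MathematicalPhysics.QuantumFieldTheory.Balaban1983to89.T3ConstrainedMinimiser (fibre)
open Literature.MathematicalPhysics.QuantumFieldTheory.Balaban1983to89.T3RegularMinimiser (regThreshold)
open Literature.MathematicalPhysics.QuantumFieldTheory.Balaban1983to89.T3PrintedRegularMinimiser (RegPr regFibrePr mem_regFibrePr_iff)
open Literature.MathematicalPhysics.QuantumFieldTheory.Balaban1983to89.T3PrintedRegularOrbits (descTransf gaugeAct_mem_regFibrePr_iff_of_trivial)
open Literature.MathematicalPhysics.QuantumFieldTheory.Balaban1983to89.T3SectALandauChart (pos_of_regPr)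
open BlockAveragingEMLLinearisedBackground (pertVar)
open Summit.QuantumFields.YangMills.Theorems.Prop7FlatHolonomy (transfUp_eq_embIter)
open Summit.QuantumFields.YangMills.Theorems.Prop7AxialGaugeFace (exists_off_embIter)
open Summit.QuantumFields.YangMills.Theorems.Prop7AxialLemma1 (iter_eq_of_mem_fibre)
open Summit.QuantumFields.YangMills.Theorems.Prop7GeodesicBlend
open Summit.QuantumFields.YangMills.Theorems.Prop7BlendBond
open Summit.QuantumFields.YangMills.Theorems.Prop7BlendCells
open Summit.QuantumFields.YangMills.Theorems.Prop7BlendSite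

section T3

variable (F : T3Family) {n K : ℕ} (h : n ≤ K)

/-- The comparison lattice of a proper member has at least three `(K−n)`-blocks per direction (`2L^{m+n} ≥ 2L ≥ 14`).
[cite: Balaban1985UV3, (1)-(3) p.256] -/
theorem three_le_sitesPerDir (hL : 7 ≤ F.L) : 3 ≤ (F.P K).sitesPerDir (K - n) := by
  show 3 ≤ 2 * F.L ^ (F.m + K - (K - n))
  have hm := F.hm
  have h1 : F.L ≤ F.L ^ (F.m + K - (K - n)) := Nat.le_self_pow (by omega) _
  omega

/-- **THE BLENDED COMB GAUGE (a (4)-representative with the `k`-uniform sup bound on EVERY bond).**  `L ≥ 7`; `50(500L + 7L²)·ε₀ ≤ 1`,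
`50(500L + 7L²)·e₀ ≤ 1`, `538800(ε₀ + e₀) ≤ 1`; `U₀ ∈ 𝔘_k(e₀) ∩ 𝔅_k(V)`, `W ∈ 𝔘_k(ε₀) ∩ 𝔅_k(V)`.  Then there is a gauge transformation `g` of the
finest lattice with `g↓ = 1` (print's group (4)) such that `W^g ∈ 𝔘_k(ε₀) ∩ 𝔅_k(V)` and `‖(W^g)_b·U₀,b⁻¹ − 1‖ ≤ 551088·(ε₀ + e₀)·L^{−(K−n)}` for every
bond `b` — uniformly in `k = K − n` and in the volume. [cite: Balaban1985Variational, (4) p.278, (18) p.280; Balaban1985RegularSpaces, Lemma 1 p.79, p.80] -/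
theorem exists_blendedGauge_T3 (hL : 7 ≤ F.L) {ε₀ e₀ : ℝ}
    (hε : 50 * (500 * (F.L : ℝ) + 7 * (F.L : ℝ) ^ 2) * ε₀ ≤ 1) (he : 50 * (500 * (F.L : ℝ) + 7 * (F.L : ℝ) ^ 2) * e₀ ≤ 1)
    (hsmall : 538800 * (ε₀ + e₀) ≤ 1)
    {V : GaugeField (F.P n) 0 (Matrix.specialUnitaryGroup (Fin 2) ℂ)} (U₀ W : GaugeField (F.P K) 0 (Matrix.specialUnitaryGroup (Fin 2) ℂ))
    (hU₀ : U₀ ∈ regFibrePr F n K h e₀ V) (hW : W ∈ regFibrePr F n K h ε₀ V) :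
    ∃ g : GaugeTransf (F.P K) 0 (Matrix.specialUnitaryGroup (Fin 2) ℂ),
      descTransf F n K h g = (fun _ => 1) ∧
      GaugeField.gaugeAct g W ∈ regFibrePr F n K h ε₀ V ∧
      ∀ b : PBond (F.P K) 0, ‖pertVar U₀ (GaugeField.gaugeAct g W) b‖ ≤ 551088 * (ε₀ + e₀) * (((F.L : ℝ))⁻¹) ^ (K - n) := by
  -- unpack the hypotheses
  have hWr : RegPr F n K ε₀ W := ((mem_regFibrePr_iff F).mp hW).2
  have hUr : RegPr F n K e₀ U₀ := ((mem_regFibrePr_iff F).mp hU₀).2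
  have hε₀ : 0 < ε₀ := pos_of_regPr F hWr
  have he₀ : 0 < e₀ := pos_of_regPr F hUr
  have hk : K - n ≤ (F.P K).m + (F.P K).K := by show K - n ≤ F.m + K; omega
  have hN : 3 ≤ (F.P K).sitesPerDir (K - n) := three_le_sitesPerDir F hL
  have hdesc := iter_eq_of_mem_fibre F h ((mem_regFibrePr_iff F).mp hW).1 ((mem_regFibrePr_iff F).mp hU₀).1
  obtain ⟨off, -, hoff⟩ := exists_off_embIter (P := F.P K) (K - n) hk
  have hd : (F.P K).d = 3 := T3Family.P_d F K
  have hLL : (F.P K).L = F.L := rfl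
  have hL0 : (0 : ℝ) < (F.L : ℝ) := by exact_mod_cast (show 0 < F.L by omega)
  have hpow : 0 < F.L ^ (K - n) := pow_pos (by omega) _
  have hsum : 0 ≤ ε₀ + e₀ := by linarith
  -- the three coordinates
  let κ0 : Fin (F.P K).d := ⟨0, by rw [hd]; norm_num⟩
  let κ1 : Fin (F.P K).d := ⟨1, by rw [hd]; norm_num⟩
  let κ2 : Fin (F.P K).d := ⟨2, by rw [hd]; norm_num⟩
  have h01 : κ0 ≠ κ1 := by intro h'; have := congrArg Fin.val h'; simp [κ0, κ1] at this
  have h02 : κ0 ≠ κ2 := by intro h'; have := congrArg Fin.val h'; simp [κ0, κ2] at this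
  have h12 : κ1 ≠ κ2 := by intro h'; have := congrArg Fin.val h'; simp [κ1, κ2] at this
  have hκ : ∀ ν : Fin (F.P K).d, ν = κ0 ∨ ν = κ1 ∨ ν = κ2 := by
    intro ν
    have hν : ν.val < 3 := ν.isLt
    have : ν.val = 0 ∨ ν.val = 1 ∨ ν.val = 2 := by omega
    rcases this with h' | h' | h'
    · left; exact Fin.ext h'
    · right; left; exact Fin.ext h'
    · right; right; exact Fin.ext h'
  -- the data of the blend
  let cz : Site (F.P K) 0 → Site (F.P K) (K - n) := fun z => iterBlockOf (K - n) (transl z (fun _ => -(off : ℤ)))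
  let rz : Site (F.P K) 0 → Fin (F.P K).d → ℕ := fun z ν => ((transl z (fun _ => -(off : ℤ))) ν).val % F.L ^ (K - n)
  let vec : Fin 2 → Fin 2 → Fin 2 → LSite (F.P K).d :=
    fun i j k ν => if ν = κ0 then ((i : ℕ) : ℤ) else if ν = κ1 then ((j : ℕ) : ℤ) else ((k : ℕ) : ℤ)
  let vE : Site (F.P K) 0 → Site (F.P K) (K - n) → Matrix (Fin 2) (Fin 2) ℂ :=
    fun x c' => (((axialT U₀ (embIter (K - n) c') x)⁻¹ * axialT W (embIter (K - n) c') x : Matrix.specialUnitaryGroup (Fin 2) ℂ) :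
      Matrix (Fin 2) (Fin 2) ℂ)
  let fam : Site (F.P K) (K - n) → Site (F.P K) 0 → Fin 2 → Fin 2 → Fin 2 → Matrix (Fin 2) (Fin 2) ℂ :=
    fun c' x i j k => vE x (transl c' (vec i j k))
  let G : ℝ → Matrix (Fin 2) (Fin 2) ℂ → Matrix (Fin 2) (Fin 2) ℂ → Matrix (Fin 2) (Fin 2) ℂ :=
    fun t a b => exp (((t : ℂ)) • mlog (b * star a)) * a
  let Bl : (Fin 2 → Fin 2 → Fin 2 → Matrix (Fin 2) (Fin 2) ℂ) → ℝ → ℝ → ℝ → Matrix (Fin 2) (Fin 2) ℂ :=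
    fun u t₀ t₁ t₂ => G t₂ (G t₁ (G t₀ (u 0 0 0) (u 1 0 0)) (G t₀ (u 0 1 0) (u 1 1 0))) (G t₁ (G t₀ (u 0 0 1) (u 1 0 1)) (G t₀ (u 0 1 1) (u 1 1 1)))
  let hh : ℝ := (F.L : ℝ) ^ (K - n)
  let gM : Site (F.P K) 0 → Matrix (Fin 2) (Fin 2) ℂ := fun z => Bl (fam (cz z) z) (rz z κ0 / hh) (rz z κ1 / hh) (rz z κ2 / hh)
  have hhpos : 0 < hh := pow_pos hL0 _
  -- constants
  set D : ℝ := 3 * ((449 / 4) * (ε₀ + e₀)) with hDdef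
  have hD507 : D ≤ 1 / 507 := by rw [hDdef]; nlinarith
  have hD1600 : D ≤ 1 / 1600 := by rw [hDdef]; nlinarith
  have hDπ : (Fintype.card (Fin 2) : ℝ) * (169 * D) < Real.pi := by
    rw [Fintype.card_fin]; push_cast
    have := Real.pi_gt_three; nlinarith
  -- the corner data at every site (for the bond direction `κ0`, used only for the family at `z`)
  have hfam : ∀ (z : Site (F.P K) 0) (μ : Fin (F.P K).d),
      (∀ i j k, fam (cz z) z i j k ∈ Matrix.specialUnitaryGroup (Fin 2) ℂ) ∧
      (∀ i j k, fam (cz z) (z.shift μ) i j k ∈ Matrix.specialUnitaryGroup (Fin 2) ℂ) ∧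
      (∀ i j k i' j' k', ‖fam (cz z) z i j k * star (fam (cz z) z i' j' k') - 1‖ ≤ D) ∧
      (∀ i j k i' j' k', ‖fam (cz z) (z.shift μ) i j k * star (fam (cz z) (z.shift μ) i' j' k') - 1‖ ≤ D) ∧
      (∀ κ, rz z κ < F.L ^ (K - n)) := by
    intro z μ
    obtain ⟨h1, h2, h3, h4, -, h6⟩ := corner_family_T3 F n K hL hε₀ he₀ hε he W U₀ hWr hUr hdesc hk hN hoff κ0 κ1 z μ
    exact ⟨h1, h2, h3, h4, h6⟩
  have hw01 : ∀ (z : Site (F.P K) 0) (κ : Fin (F.P K).d), 0 ≤ (rz z κ : ℝ) / hh ∧ (rz z κ : ℝ) / hh ≤ 1 := by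
    intro z κ
    refine ⟨by positivity, ?_⟩
    rw [div_le_one hhpos]
    show ((rz z κ : ℕ) : ℝ) ≤ (F.L : ℝ) ^ (K - n)
    exact_mod_cast ((hfam z κ0).2.2.2.2 κ).le
  -- SU-membership of the blend
  have hmem : ∀ z, gM z ∈ Matrix.specialUnitaryGroup (Fin 2) ℂ := by
    intro z
    obtain ⟨hvSU, -, hvv, -, -⟩ := hfam z κ0
    exact blend_mem_specialUnitaryGroup G arc_hmem arc_hmemSU arc_hnear (fam (cz z) z) hvSU hD507 hDπ hvv (rz z κ2 / hh)
      (hw01 z κ0).1 (hw01 z κ0).2 (hw01 z κ1).1 (hw01 z κ1).2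
  -- THE GAUGE TRANSFORMATION
  let g : GaugeTransf (F.P K) 0 (Matrix.specialUnitaryGroup (Fin 2) ℂ) := fun z => ⟨gM z, hmem z⟩
  -- (4): `g = 1` at the centres
  have hcentre : ∀ c₀ : Site (F.P K) (K - n), g (embIter (K - n) c₀) = 1 := by
    intro c₀
    apply Subtype.ext
    show gM (embIter (K - n) c₀) = 1
    obtain ⟨hc, hr⟩ := cell_centre hk hoff c₀
    have hr' : ∀ κ, (rz (embIter (K - n) c₀) κ : ℝ) / hh = 0 := by
      intro κ; have : rz (embIter (K - n) c₀) κ = 0 := hr κ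
      rw [this, Nat.cast_zero, zero_div]
    show Bl (fam (cz (embIter (K - n) c₀)) (embIter (K - n) c₀)) (rz (embIter (K - n) c₀) κ0 / hh) (rz (embIter (K - n) c₀) κ1 / hh)
      (rz (embIter (K - n) c₀) κ2 / hh) = 1
    rw [hr' κ0, hr' κ1, hr' κ2]
    show G 0 (G 0 (G 0 _ _) (G 0 _ _)) (G 0 (G 0 _ _) (G 0 _ _)) = 1
    rw [blend_corner G arc_h0]
    have hcz : cz (embIter (K - n) c₀) = c₀ := hc
    have hvec0 : vec 0 0 0 = 0 := by funext ν; simp [vec]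
    show vE (embIter (K - n) c₀) (transl (cz (embIter (K - n) c₀)) (vec 0 0 0)) = 1
    rw [hcz, hvec0, transl_zero]
    simp only [vE, axialT_self, inv_one, one_mul, OneMemClass.coe_one]
  refine ⟨g, ?_, ?_, ?_⟩
  · funext x
    unfold descTransf
    rw [transfUp_eq_embIter]
    exact hcentre _
  · have h4 : descTransf F n K h g = fun _ => 1 := by
      funext x; unfold descTransf; rw [transfUp_eq_embIter]; exact hcentre _
    exact (gaugeAct_mem_regFibrePr_iff_of_trivial F h hε₀.le h4 W V).mpr hW
  -- THE BOUND ON EVERY BOND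
  rintro ⟨z, μ⟩
  show dist1 (g z * W ⟨z, μ⟩ * (g (z.shift μ))⁻¹ * (U₀ ⟨z, μ⟩)⁻¹) ≤ _
  rw [dist1_transport_eq]
  show ‖gM z * ((W ⟨z, μ⟩ : Matrix.specialUnitaryGroup (Fin 2) ℂ) : Matrix (Fin 2) (Fin 2) ℂ) * star (gM (z.shift μ)) *
      star ((U₀ ⟨z, μ⟩ : Matrix.specialUnitaryGroup (Fin 2) ℂ) : Matrix (Fin 2) (Fin 2) ℂ) - 1‖ ≤ _
  -- the weights of `z + e_μ` from the cell of `z`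
  let r' : Fin (F.P K).d → ℕ := fun ν => rz z ν + if ν = μ then 1 else 0
  have hbond := blend_bond_le_T3 F n K hL hε₀ he₀ hε he hsmall W U₀ hWr hUr hdesc hk hN hoff κ0 κ1 κ2 h01 h02 h12 z μ
  -- it remains to identify `gM (z + e_μ)` with the blend of the OLD corners at the NEW weights
  suffices hid : gM (z.shift μ) = Bl (fam (cz z) (z.shift μ)) (r' κ0 / hh) (r' κ1 / hh) (r' κ2 / hh) by
    rw [hid]; exact hbond
  obtain ⟨-, hwSU, -, hww, hrlt⟩ := hfam z μ
  have hwU : ∀ i j k, fam (cz z) (z.shift μ) i j k ∈ Matrix.unitaryGroup (Fin 2) ℂ := fun i j k =>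
    (Matrix.mem_specialUnitaryGroup_iff.1 (hwSU i j k)).1
  have hrμ : rz z μ < F.L ^ (K - n) := hrlt μ
  rcases Nat.lt_or_ge (rz z μ) (F.L ^ (K - n) - 1) with hint | hge
  · -- INTERIOR STEP: same cell, `r_μ ↦ r_μ + 1`
    obtain ⟨hc, hrμ', hrν⟩ := cell_shift_of_lt (P := F.P K) hk (off := off) z μ (by rw [hLL]; exact hint)
    have hr' : ∀ κ, rz (z.shift μ) κ = r' κ := by
      intro κ
      by_cases hκμ : κ = μ
      · subst hκμ; show _ = rz z κ + if κ = κ then 1 else 0; rw [if_pos rfl]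
        have := hrμ'; rw [hLL] at this; exact this
      · show _ = rz z κ + if κ = μ then 1 else 0; rw [if_neg hκμ, add_zero]
        have := hrν κ hκμ; rw [hLL] at this; exact this
    show Bl (fam (cz (z.shift μ)) (z.shift μ)) (rz (z.shift μ) κ0 / hh) (rz (z.shift μ) κ1 / hh) (rz (z.shift μ) κ2 / hh) = _
    have hcz : cz (z.shift μ) = cz z := hc
    rw [hcz, hr' κ0, hr' κ1, hr' κ2]
  · -- FACE STEP: the shifted cell, `r_μ ↦ 0`; the blend is single-valued across the cells of centres
    have hface : rz z μ = F.L ^ (K - n) - 1 := by omega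
    obtain ⟨hc, hrμ', hrν⟩ := cell_shift_of_eq (P := F.P K) hk (off := off) z μ (by rw [hLL]; exact hface)
    have hcz : cz (z.shift μ) = (cz z).shift μ := hc
    have hr0 : (rz (z.shift μ) μ : ℝ) / hh = 0 := by
      have : rz (z.shift μ) μ = 0 := by have := hrμ'; rw [hLL] at this; exact this
      rw [this, Nat.cast_zero, zero_div]
    have hrsame : ∀ κ, κ ≠ μ → rz (z.shift μ) κ = rz z κ := by
      intro κ hκμ; have := hrν κ hκμ; rw [hLL] at this; exact this
    have hr'μ : (r' μ : ℝ) / hh = 1 := by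
      show ((rz z μ + if μ = μ then 1 else 0 : ℕ) : ℝ) / hh = 1
      rw [if_pos rfl, hface, Nat.sub_add_cancel (Nat.one_le_pow _ _ (by omega)), Nat.cast_pow, div_self hhpos.ne']
    have hr'same : ∀ κ, κ ≠ μ → r' κ = rz z κ := by
      intro κ hκμ; show rz z κ + (if κ = μ then 1 else 0) = rz z κ; rw [if_neg hκμ, add_zero]
    -- the shifted cell's corners: `(c + e_μ) + ε = c + (ε + e_μ)`
    have hshift : ∀ ε : LSite (F.P K).d, transl ((cz z).shift μ) ε = transl (cz z) (Function.update ε μ (ε μ + 1)) := by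
      intro ε; funext ν
      simp only [transl_apply, Site.shift]
      by_cases hν : ν = μ
      · subst hν; simp only [Function.update_self]; push_cast; ring
      · simp only [Function.update_of_ne hν]
    -- level data of the old family `w` at `z + e_μ` (weights of the two untouched coordinates)
    obtain ⟨hA, hAA, hB, hBB, -⟩ := blend_mem_unitaryGroup G arc_hmem arc_hnear (fam (cz z) (z.shift μ)) hwU hD507 hww (rz z κ1 / hh)
      (hw01 z κ0).1 (hw01 z κ0).2 (hw01 z κ1).1 (hw01 z κ1).2
    have hD1 : D < 1 := by linarith
    have h13D1 : 13 * D < 1 := by linarith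
    have h169D1 : 169 * D < 1 := by linarith
    -- the corner vectors of the shifted cell
    have hval0 : ((((0 : Fin 2) : ℕ) : ℤ)) = 0 := by simp
    have hval1 : ((((1 : Fin 2) : ℕ) : ℤ)) = 1 := by simp
    have hv0 : ∀ j k, Function.update (vec 0 j k) κ0 (vec 0 j k κ0 + 1) = vec 1 j k := by
      intro j k; funext ν
      by_cases hν : ν = κ0
      · subst hν; simp only [Function.update_self, vec, if_pos rfl, hval0, hval1]; ring
      · rw [Function.update_of_ne hν]; simp only [vec, if_neg hν]
    have hv1 : ∀ i k, Function.update (vec i 0 k) κ1 (vec i 0 k κ1 + 1) = vec i 1 k := by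
      intro i k; funext ν
      by_cases hν : ν = κ1
      · subst hν; simp [vec]
        split_ifs with hc
        · exact absurd hc (Ne.symm h01)
        · norm_num
      · rw [Function.update_of_ne hν]; simp only [vec, if_neg hν]
    have hv2 : ∀ i j, Function.update (vec i j 0) κ2 (vec i j 0 κ2 + 1) = vec i j 1 := by
      intro i j; funext ν
      by_cases hν : ν = κ2
      · subst hν; simp [vec]
        split_ifs with hc hc'
        · exact absurd hc (Ne.symm h02)
        · exact absurd hc' (Ne.symm h12)
        · norm_num
      · rw [Function.update_of_ne hν]
        rcases hκ ν with h' | h' | h'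
        · simp [vec, h']
        · simp [vec, h']
        · exact absurd h' hν
    show Bl (fam (cz (z.shift μ)) (z.shift μ)) (rz (z.shift μ) κ0 / hh) (rz (z.shift μ) κ1 / hh) (rz (z.shift μ) κ2 / hh) = _
    rw [hcz]
    rcases hκ μ with hμ | hμ | hμ
    · -- crossing in the first coordinate
      subst hμ
      have hw' : ∀ j k, fam ((cz z).shift κ0) (z.shift κ0) 0 j k = fam (cz z) (z.shift κ0) 1 j k := by
        intro j k; show vE _ (transl ((cz z).shift κ0) (vec 0 j k)) = vE _ (transl (cz z) (vec 1 j k)); rw [hshift, hv0]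
      rw [hr0, show rz (z.shift κ0) κ1 = r' κ1 by rw [hrsame κ1 (Ne.symm h01), hr'same κ1 (Ne.symm h01)],
        show rz (z.shift κ0) κ2 = r' κ2 by rw [hrsame κ2 (Ne.symm h02), hr'same κ2 (Ne.symm h02)], hr'μ]
      show G _ (G _ (G 0 _ _) (G 0 _ _)) (G _ (G 0 _ _) (G 0 _ _)) = G _ (G _ (G 1 _ _) (G 1 _ _)) (G _ (G 1 _ _) (G 1 _ _))
      rw [blend_face₁₀ G arc_h0 (fam ((cz z).shift κ0) (z.shift κ0)), hw', hw', hw', hw',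
        blend_face₁₁ G arc_h1 (fam (cz z) (z.shift κ0)) hwU (fun j k => (hww 1 j k 0 j k).trans_lt hD1)]
    · -- crossing in the second coordinate
      subst hμ
      have hw' : ∀ i k, fam ((cz z).shift κ1) (z.shift κ1) i 0 k = fam (cz z) (z.shift κ1) i 1 k := by
        intro i k; show vE _ (transl ((cz z).shift κ1) (vec i 0 k)) = vE _ (transl (cz z) (vec i 1 k)); rw [hshift, hv1]
      rw [hr0, show rz (z.shift κ1) κ0 = r' κ0 by rw [hrsame κ0 h01, hr'same κ0 h01],
        show rz (z.shift κ1) κ2 = r' κ2 by rw [hrsame κ2 (Ne.symm h12), hr'same κ2 (Ne.symm h12)], hr'μ, hr'same κ0 h01]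
      show G _ (G 0 (G _ _ _) (G _ _ _)) (G 0 (G _ _ _) (G _ _ _)) = G _ (G 1 (G _ _ _) (G _ _ _)) (G 1 (G _ _ _) (G _ _ _))
      rw [blend_face₂₀ G arc_h0 (fam ((cz z).shift κ1) (z.shift κ1)), hw', hw', hw', hw',
        blend_face₂₁ G arc_h1 (fam (cz z) (z.shift κ1)) (fun k => hA 0 k) (fun k => (hAA 1 k 0 k).trans_lt h13D1)]
    · -- crossing in the third coordinate
      subst hμ
      have hw' : ∀ i j, fam ((cz z).shift κ2) (z.shift κ2) i j 0 = fam (cz z) (z.shift κ2) i j 1 := by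
        intro i j; show vE _ (transl ((cz z).shift κ2) (vec i j 0)) = vE _ (transl (cz z) (vec i j 1)); rw [hshift, hv2]
      rw [hr0, show rz (z.shift κ2) κ0 = r' κ0 by rw [hrsame κ0 h02, hr'same κ0 h02],
        show rz (z.shift κ2) κ1 = r' κ1 by rw [hrsame κ1 h12, hr'same κ1 h12], hr'μ, hr'same κ0 h02, hr'same κ1 h12]
      show G 0 (G _ (G _ _ _) (G _ _ _)) (G _ (G _ _ _) (G _ _ _)) = G 1 (G _ (G _ _ _) (G _ _ _)) (G _ (G _ _ _) (G _ _ _))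
      rw [blend_face₃₀ G arc_h0 (fam ((cz z).shift κ2) (z.shift κ2)), hw', hw', hw', hw',
        blend_face₃₁ G arc_h1 (fam (cz z) (z.shift κ2)) (hB 0) (by rw [udist_symm]; exact hBB.trans_lt h169D1)]

end T3

end Summit.QuantumFields.YangMills.Theorems.Prop7BlendedGauge

end
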